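import Mathlib
import HarnessLib

/-!
# Erdős–Littlewood–Offord anti-concentration with unequal steps (stub S1)

If `N` independent `ℤ`-valued random variables have laws `f i` (supported in a finite `supp ⊆ ℤ`)
with two atoms `u i + d ≤ v i` of mass `≥ p` each, then every window `[y, y + d)` has mass at most
`C(p) / √(N+1)` under the law of the sum (Erdős 1945, Littlewood–Offord with unequal steps); the
probability is the finite sum over `Fintype.piFinset` of product weights consumed by
`WindowExtinction_of`.  Proof (mixture argument): write `f i = p · 1_{u i, v i} + r i` with
`r i ≥ 0` of mass `1 - 2p` and expand (`Finset.prod_add`) into a mixture over the set `T` of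
two-atom coordinates.  Given `T` and the coordinates outside `T`, the window mass is `p ^ |T|`
times the number of patterns `a ∈ ∏_{i ∈ T} {u i, v i}` whose sum lands in the window; their
sets `{i | a i = v i}` are pairwise non-nested (a strict inclusion moves the sum by `≥ d`, the
window length), so Sperner's theorem (`IsAntichain.sperner`) bounds their number by
`binom(|T|, |T|/2) ≤ 2^|T| / √(|T|+1)`, and averaging against the binomial law of `|T|` gives
`C = 1 + 1/(4p)`.  The binomial bookkeeping is adapted from
`Theorems/SpectralDefectExtinctionWindowExtinctionStubLittlewoodOfford.lean` (equal steps).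
-/

noncomputable section

namespace Summit.QuantumFields.QCD.Cruxes.WindowExtinction.WallConditionedCellSpread

open Finset
open scoped BigOperators

-- The next four lemmas are adapted from
-- Theorems/SpectralDefectExtinctionWindowExtinctionStubLittlewoodOfford.lean (private there).

/-- Central binomial bound with the correct polynomial factor: `(2n+1) · binom(2n,n)² ≤ 16^n`. -/
private theorem centralBinom_sq_bound (n : ℕ) : (2 * n + 1) * Nat.centralBinom n ^ 2 ≤ 16 ^ n := by
  induction n with
  | zero => simp
  | succ n ih =>
    refine Nat.le_of_mul_le_mul_left ?_ (show 0 < (n + 1) ^ 2 by positivity)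
    have hq : (2 * n + 3) * (2 * n + 1) ≤ 4 * (n + 1) ^ 2 := by nlinarith
    calc (n + 1) ^ 2 * ((2 * (n + 1) + 1) * Nat.centralBinom (n + 1) ^ 2)
        = (2 * n + 3) * ((n + 1) * Nat.centralBinom (n + 1)) ^ 2 := by ring
      _ = 4 * ((2 * n + 3) * (2 * n + 1)) * ((2 * n + 1) * Nat.centralBinom n ^ 2) := by
          rw [Nat.succ_mul_centralBinom_succ n]; ring
      _ ≤ 4 * (4 * (n + 1) ^ 2) * 16 ^ n := by gcongr
      _ = (n + 1) ^ 2 * 16 ^ (n + 1) := by ring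

/-- Middle binomial coefficient bound: `(M+1) · binom(M, ⌊M/2⌋)² ≤ 4^M`. -/
private theorem middle_choose_sq_bound (M : ℕ) : (M + 1) * M.choose (M / 2) ^ 2 ≤ 4 ^ M := by
  obtain ⟨n, rfl | rfl⟩ := Nat.even_or_odd' M
  · rw [show 2 * n / 2 = n by omega, ← Nat.centralBinom_eq_two_mul_choose, pow_mul]
    exact centralBinom_sq_bound n
  · rw [show (2 * n + 1) / 2 = n by omega]
    have h2 : Nat.centralBinom (n + 1) = 2 * (2 * n + 1).choose n := by
      rw [Nat.centralBinom_eq_two_mul_choose, show 2 * (n + 1) = (2 * n + 1) + 1 by ring,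
        Nat.choose_succ_succ', Nat.choose_symm_half]
      ring
    have h3 := centralBinom_sq_bound (n + 1)
    rw [h2] at h3
    have h5 : 4 * ((2 * n + 3) * (2 * n + 1).choose n ^ 2) ≤ 4 * 4 ^ (2 * n + 1) := by
      calc 4 * ((2 * n + 3) * (2 * n + 1).choose n ^ 2)
          = (2 * (n + 1) + 1) * (2 * (2 * n + 1).choose n) ^ 2 := by ring
        _ ≤ 16 ^ (n + 1) := h3
        _ = 4 * 4 ^ (2 * n + 1) := by rw [show (16 : ℕ) = 4 ^ 2 by norm_num, ← pow_mul]; ring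
    calc (2 * n + 1 + 1) * (2 * n + 1).choose n ^ 2 ≤ (2 * n + 3) * (2 * n + 1).choose n ^ 2 :=
          Nat.mul_le_mul_right _ (by omega)
      _ ≤ _ := Nat.le_of_mul_le_mul_left h5 (by norm_num)

/-- Real form of the middle binomial bound, linearised in `1/√(M+1)` by AM–GM:
`binom(M, ⌊M/2⌋) ≤ 2^M · (1/(2σ) + σ/(2(M+1)))` for every `σ > 0`. -/
private theorem middle_choose_le (M : ℕ) (σ : ℝ) (hσ : 0 < σ) :
    (M.choose (M / 2) : ℝ) ≤ 2 ^ M * (1 / (2 * σ) + σ / (2 * (M + 1))) := by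
  have h1 : ((M : ℝ) + 1) * (M.choose (M / 2) : ℝ) ^ 2 ≤ ((2 : ℝ) ^ M) ^ 2 := by
    have h4 : ((4 : ℝ) ^ M) = ((2 : ℝ) ^ M) ^ 2 := by rw [sq, ← mul_pow]; norm_num
    rw [← h4]
    exact_mod_cast middle_choose_sq_bound M
  set X : ℝ := (M.choose (M / 2) : ℝ)
  set P : ℝ := (2 : ℝ) ^ M
  have hP : 0 < P := by positivity
  have hM : (0 : ℝ) < (M : ℝ) + 1 := by positivity
  have key : 2 * σ * ((M : ℝ) + 1) * X ≤ P * (σ ^ 2 + ((M : ℝ) + 1)) := by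
    refine le_of_mul_le_mul_right ?_ hP
    nlinarith [sq_nonneg (σ * P - ((M : ℝ) + 1) * X), mul_le_mul_of_nonneg_left h1 hM.le]
  have h3 : P * (1 / (2 * σ) + σ / (2 * ((M : ℝ) + 1)))
      = P * (σ ^ 2 + ((M : ℝ) + 1)) / (2 * σ * ((M : ℝ) + 1)) := by
    field_simp
    ring
  rw [h3, le_div_iff₀ (by positivity)]
  linarith [key]

/-- Binomial average of `1/(M+1)`: for `M ~ Bin(N, q)` one has `(N+1) q · E[1/(M+1)] ≤ 1`,
written as a sum over subsets of `Fin N`. -/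
private theorem binomial_inv_succ_sum_le (N : ℕ) (q : ℝ) (hq1 : q ≤ 1) :
    ((N : ℝ) + 1) * q * ∑ T ∈ (univ : Finset (Fin N)).powerset,
        q ^ #T * (1 - q) ^ (N - #T) / (#T + 1) ≤ 1 := by
  have h1 : ∑ T ∈ (univ : Finset (Fin N)).powerset, q ^ #T * (1 - q) ^ (N - #T) / (#T + 1)
      = ∑ m ∈ range (N + 1), (N.choose m : ℝ) * (q ^ m * (1 - q) ^ (N - m) / (m + 1)) := by
    rw [Finset.sum_powerset_apply_card (fun m => q ^ m * (1 - q) ^ (N - m) / ((m : ℝ) + 1))]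
    simp [nsmul_eq_mul]
  have h2 : ∀ m : ℕ, ((N : ℝ) + 1) * (N.choose m : ℝ) / ((m : ℝ) + 1)
      = ((N + 1).choose (m + 1) : ℝ) := fun m => by
    rw [div_eq_iff (by positivity)]
    exact_mod_cast Nat.add_one_mul_choose_eq N m
  have h3 : ((N : ℝ) + 1) * q * ∑ T ∈ (univ : Finset (Fin N)).powerset,
        q ^ #T * (1 - q) ^ (N - #T) / (#T + 1)
      = ∑ m ∈ range (N + 1), ((N + 1).choose (m + 1) : ℝ) * (q ^ (m + 1) * (1 - q) ^ (N - m)) := by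
    rw [h1, mul_sum]
    refine sum_congr rfl (fun m _ => ?_)
    rw [← h2 m]
    have : (m : ℝ) + 1 ≠ 0 := by positivity
    field_simp
    ring
  have h5 : (0 : ℝ) ≤ ((N + 1).choose 0 : ℝ) * (q ^ 0 * (1 - q) ^ (N + 1 - 0)) :=
    mul_nonneg (by positivity) (mul_nonneg (by positivity) (pow_nonneg (by linarith) _))
  calc _ = _ := h3
    _ ≤ ∑ m ∈ range (N + 1), ((N + 1).choose (m + 1) : ℝ) * (q ^ (m + 1) * (1 - q) ^ (N - m))
          + ((N + 1).choose 0 : ℝ) * (q ^ 0 * (1 - q) ^ (N + 1 - 0)) := le_add_of_nonneg_right h5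
    _ = ∑ m ∈ range (N + 1 + 1), ((N + 1).choose m : ℝ) * (q ^ m * (1 - q) ^ (N + 1 - m)) := by
        rw [Finset.sum_range_succ'
          (fun m => ((N + 1).choose m : ℝ) * (q ^ m * (1 - q) ^ (N + 1 - m))) (N + 1)]
        simp only [Nat.add_sub_add_right]
    _ = (q + (1 - q)) ^ (N + 1) := by rw [add_pow]; exact sum_congr rfl (fun m _ => by ring)
    _ = 1 := by simp

/-- Sperner step.  Among two-atom patterns `a : κ → S` (`a i ∈ {u i, v i}`) with steps
`val (v i) - val (u i) ≥ d`, those whose `val`-sum lands in a half-open window of length `d` are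
at most `binom(|κ|, |κ|/2)` in number: a pattern is determined by the set `{i | a i = v i}`, and
these sets are pairwise non-nested (a strict inclusion moves the sum by `≥ d`). -/
private theorem card_twoAtom_window_le (κ : Type*) [Fintype κ] [DecidableEq κ] {S : Type*}
    [Fintype S] [DecidableEq S] (val : S → ℤ) (u v : κ → S) (d : ℕ)
    (huv : ∀ i, val (u i) + d ≤ val (v i)) (c y : ℤ) :
    #({a ∈ (univ : Finset (κ → S)) | (∀ i, a i = u i ∨ a i = v i) ∧
        (y ≤ (∑ i, val (a i)) + c ∧ (∑ i, val (a i)) + c < y + d)})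
      ≤ (Fintype.card κ).choose (Fintype.card κ / 2) := by
  set 𝒜 := ({a ∈ (univ : Finset (κ → S)) | (∀ i, a i = u i ∨ a i = v i) ∧
    (y ≤ (∑ i, val (a i)) + c ∧ (∑ i, val (a i)) + c < y + d)})
  have hmem : ∀ a ∈ 𝒜, (∀ i, a i = u i ∨ a i = v i) ∧
      (y ≤ (∑ i, val (a i)) + c ∧ (∑ i, val (a i)) + c < y + d) := fun a ha => (mem_filter.1 ha).2
  -- the set of `v`-coordinates of a pattern determines it, and two such sets are never nested
  set φ : (κ → S) → Finset κ := fun a => univ.filter (fun i => a i = v i) with hφ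
  have hφ_mem : ∀ a i, i ∈ φ a ↔ a i = v i := fun a i => by simp [hφ]
  have hinj : Set.InjOn φ 𝒜 := by
    intro a ha a' ha' h
    funext i
    have hi : (a i = v i ↔ a' i = v i) := by rw [← hφ_mem, ← hφ_mem, h]
    by_cases h1 : a i = v i
    · rw [h1, hi.1 h1]
    · rw [((hmem a ha).1 i).resolve_right h1,
        ((hmem a' ha').1 i).resolve_right (fun h2 => h1 (hi.2 h2))]
  have hanti : IsAntichain (· ⊆ ·) (SetLike.coe (𝒜.image φ)) := by
    intro B hB B' hB' hne hBB'
    obtain ⟨a, ha, rfl⟩ := mem_image.1 (mem_coe.1 hB)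
    obtain ⟨a', ha', rfl⟩ := mem_image.1 (mem_coe.1 hB')
    obtain ⟨⟨htwo, hwin⟩, htwo', hwin'⟩ := And.intro (hmem a ha) (hmem a' ha')
    have hstep : ∀ i, 0 ≤ val (a' i) - val (a i) := by
      intro i
      have := huv i
      rcases htwo i with h1 | h1
      · rcases htwo' i with h2 | h2 <;> rw [h1, h2] <;> omega
      · rw [h1, (hφ_mem a' i).1 (hBB' ((hφ_mem a i).2 h1))]; omega
    obtain ⟨i₀, hi₀', hi₀⟩ := exists_of_ssubset (hBB'.ssubset_of_ne hne)
    have h0 : (d : ℤ) ≤ val (a' i₀) - val (a i₀) := by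
      have := huv i₀
      rw [(htwo i₀).resolve_right (fun h => hi₀ ((hφ_mem a i₀).2 h)), (hφ_mem a' i₀).1 hi₀']
      omega
    have hsum := h0.trans (single_le_sum (fun i _ => hstep i) (mem_univ i₀))
    rw [sum_sub_distrib] at hsum
    omega
  rw [← card_image_of_injOn hinj]
  exact hanti.sperner

/-- Pointwise bookkeeping identity used in the conditioning step. -/
private theorem boole_mul_mul_boole_mul (P Q : Prop) [Decidable P] [Decidable Q] (A B : ℝ) :
    (if P then (1 : ℝ) else 0) * ((A * (if Q then (1 : ℝ) else 0)) * B)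
      = B * (A * (if Q ∧ P then (1 : ℝ) else 0)) := by
  by_cases hP : P <;> by_cases hQ : Q <;> simp [hP, hQ, mul_comm]

/-- Conditioning step.  For a fixed set `T` of two-atom coordinates, the window mass of the
`T`-component of the mixture is at most `p ^ |T| · binom(|T|, |T|/2)` times the total `r`-mass of
the coordinates outside `T` (split `z = (z|_T, z|_{Tᶜ})`, fix `z|_{Tᶜ}`, count with
`card_twoAtom_window_le` on `T`). -/
private theorem sum_window_prod_le (N : ℕ) {S : Type*} [Fintype S] [DecidableEq S]
    (val : S → ℤ) (T : Finset (Fin N)) (u v : Fin N → S) (d : ℕ)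
    (huv : ∀ i, val (u i) + d ≤ val (v i)) (p : ℝ) (hp : 0 ≤ p) (r : Fin N → S → ℝ)
    (hr : ∀ i s, 0 ≤ r i s) (y : ℤ) :
    ∑ z : Fin N → S, (if y ≤ ∑ i, val (z i) ∧ ∑ i, val (z i) < y + d then (1 : ℝ) else 0) *
        ((∏ i ∈ T, p * (if z i = u i ∨ z i = v i then (1 : ℝ) else 0)) *
          ∏ i ∈ univ \ T, r i (z i))
      ≤ p ^ #T * ((#T).choose (#T / 2) : ℝ) * ∏ i ∈ univ \ T, ∑ s, r i s := by
  set e := Equiv.piEquivPiSubtypeProd (· ∈ T) (fun _ : Fin N => S) with he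
  have hsub : ∀ x : Fin N, x ∈ univ \ T ↔ ¬ (x ∈ T) := by simp
  -- the three factors in the split coordinates `z = e.symm (a, b)`
  have hF : ∀ (a : {x // x ∈ T} → S) (b : {x // x ∉ T} → S),
      ∏ i ∈ univ \ T, r i (e.symm (a, b) i) = ∏ i : {x // x ∉ T}, r i (b i) := fun a b => by
    rw [prod_subtype (univ \ T) hsub]
    exact Fintype.prod_congr _ _ (fun i => by simp [he, i.2])
  have hG : ∀ (a : {x // x ∈ T} → S) (b : {x // x ∉ T} → S),
      ∏ i ∈ T, p * (if e.symm (a, b) i = u i ∨ e.symm (a, b) i = v i then (1 : ℝ) else 0)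
        = p ^ #T * (if ∀ i : {x // x ∈ T}, (a i = u i ∨ a i = v i) then (1 : ℝ) else 0) := by
    intro a b
    have h1 : ∏ i ∈ T, p * (if e.symm (a, b) i = u i ∨ e.symm (a, b) i = v i then (1 : ℝ) else 0)
        = ∏ i : {x // x ∈ T}, p * (if a i = u i ∨ a i = v i then (1 : ℝ) else 0) := by
      rw [prod_subtype (p := (· ∈ T)) T (fun _ => Iff.rfl)]
      exact Fintype.prod_congr _ _ (fun i => by rw [show e.symm (a, b) i = a i by simp [he, i.2]])
    rw [h1, prod_mul_distrib, prod_const, Finset.card_univ, Fintype.card_coe, Fintype.prod_boole]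
  have hS : ∀ (a : {x // x ∈ T} → S) (b : {x // x ∉ T} → S), (∑ i, val (e.symm (a, b) i)) =
      (∑ i : {x // x ∈ T}, val (a i)) + ∑ i : {x // x ∉ T}, val (b i) := fun a b => by
    rw [← Fintype.sum_subtype_add_sum_subtype (· ∈ T)]
    congr 1
    · exact Finset.sum_congr (by ext; simp) (fun i _ => by simp [he, i.2])
    · exact Fintype.sum_congr _ _ (fun i => by simp [he, i.2])
  have hR : ∑ b : {x // x ∉ T} → S, ∏ i : {x // x ∉ T}, r i (b i)
      = ∏ i ∈ univ \ T, ∑ s, r i s := by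
    rw [prod_subtype (univ \ T) hsub (fun i => ∑ s, r i s)]
    exact (Fintype.prod_sum (fun (i : {x // x ∉ T}) (s : S) => r i s)).symm
  rw [← Equiv.sum_comp e.symm, Fintype.sum_prod_type_right, ← hR, mul_sum]
  refine sum_le_sum (fun b _ => ?_)
  -- the Sperner count, given the outside coordinates `b`
  have hcount : ∑ a : {x // x ∈ T} → S,
      (if (∀ i : {x // x ∈ T}, (a i = u i ∨ a i = v i)) ∧
          (y ≤ (∑ i, val (a i)) + (∑ i : {x // x ∉ T}, val (b i)) ∧
            (∑ i, val (a i)) + (∑ i : {x // x ∉ T}, val (b i)) < y + d) then (1 : ℝ) else 0)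
        ≤ ((#T).choose (#T / 2) : ℝ) := by
    rw [sum_boole]
    have := card_twoAtom_window_le {x // x ∈ T} val (fun i => u i) (fun i => v i) d
      (fun i => huv i) (∑ i : {x // x ∉ T}, val (b i)) y
    rw [Fintype.card_coe] at this
    exact_mod_cast this
  calc _ = ∑ a : {x // x ∈ T} → S, (∏ i : {x // x ∉ T}, r i (b i)) * (p ^ #T *
          (if (∀ i : {x // x ∈ T}, (a i = u i ∨ a i = v i)) ∧
              (y ≤ (∑ i, val (a i)) + (∑ i : {x // x ∉ T}, val (b i)) ∧
                (∑ i, val (a i)) + (∑ i : {x // x ∉ T}, val (b i)) < y + d)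
            then (1 : ℝ) else 0)) :=
        Fintype.sum_congr _ _ (fun a => by
          rw [hF a b, hG a b, hS a b]; exact boole_mul_mul_boole_mul _ _ _ _)
    _ ≤ (∏ i : {x // x ∉ T}, r i (b i)) * (p ^ #T * ((#T).choose (#T / 2) : ℝ)) := by
        rw [← mul_sum, ← mul_sum]
        exact mul_le_mul_of_nonneg_left (mul_le_mul_of_nonneg_left hcount (pow_nonneg hp _))
          (prod_nonneg (fun i _ => hr _ _))
    _ = _ := by ring

/-- A sum over `Fintype.piFinset fun _ => supp` is a sum over all maps into the subtype `supp`. -/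
private theorem sum_piFinset_eq_sum_pi {N : ℕ} (supp : Finset ℤ) (F : (Fin N → ℤ) → ℝ) :
    ∑ z ∈ Fintype.piFinset (fun _ : Fin N => supp), F z
      = ∑ z : Fin N → supp, F (fun i => (z i : ℤ)) := by
  refine (sum_bij (fun (z : Fin N → supp) _ => fun i => (z i : ℤ)) ?_ ?_ ?_ ?_).symm
  · exact fun z _ => Fintype.mem_piFinset.2 (fun i => (z i).2)
  · exact fun z₁ _ z₂ _ h => funext (fun i => Subtype.ext (congrFun h i))
  · exact fun w hw => ⟨fun i => ⟨w i, Fintype.mem_piFinset.1 hw i⟩, mem_univ _, rfl⟩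
  · exact fun z _ => rfl

/-- **S1 — Erdős–Littlewood–Offord with unequal steps (two-atom spread, finite product-weight
form).**  For every `p > 0` there is `C > 0` (`C = 1 + 1/(4p)`) such that: if `N` independent
`ℤ`-valued variables have laws `f i ≥ 0` of mass `1` on a finite set `supp`, each with two atoms
`u i + d ≤ v i` (`d ≥ 1`) of mass `≥ p`, then every window `[y, y + d)` has probability
`≤ C / √(N+1)` under the law of the sum, the probability being the sum over
`Fintype.piFinset fun _ => supp` of the product weights (Erdős 1945, via Sperner's theorem). -/
theorem stub_erdosLittlewoodOfford :
    ∀ p : ℝ, 0 < p → ∃ C : ℝ, 0 < C ∧ ∀ (N d : ℕ), 0 < d →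
      ∀ (supp : Finset ℤ) (f : Fin N → ℤ → ℝ), (∀ i z, 0 ≤ f i z) → (∀ i, ∑ z ∈ supp, f i z = 1) →
        (∀ i, ∃ u ∈ supp, ∃ v ∈ supp, u + d ≤ v ∧ p ≤ f i u ∧ p ≤ f i v) →
        ∀ y : ℤ, (∑ z ∈ (Fintype.piFinset fun _ : Fin N => supp) with
            (y ≤ ∑ i, z i ∧ ∑ i, z i < y + d), ∏ i, f i (z i)) ≤ C / Real.sqrt (N + 1) := by
  intro p hp
  refine ⟨1 + 1 / (4 * p), by positivity, fun N d hd supp f hf0 hf1 hatom y => ?_⟩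
  have hC1 : (1 : ℝ) ≤ 1 + 1 / (4 * p) := le_add_of_nonneg_right (by positivity)
  rcases Nat.eq_zero_or_pos N with rfl | hN
  · -- `N = 0`: the window mass is at most the total mass `1`.
    have h2 : ∑ z ∈ Fintype.piFinset (fun _ : Fin 0 => supp), ∏ i, f i (z i) = 1 := by
      rw [sum_prod_piFinset supp f]; simp
    calc _ ≤ ∑ z ∈ Fintype.piFinset (fun _ : Fin 0 => supp), ∏ i, f i (z i) :=
          sum_le_sum_of_subset_of_nonneg (filter_subset _ _)
            (fun z _ _ => prod_nonneg (fun i _ => hf0 i (z i)))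
      _ ≤ (1 + 1 / (4 * p)) / Real.sqrt ((0 : ℕ) + 1) := by rw [h2]; simpa using hC1
  -- `N ≥ 1`: then `2p ≤ 1`.
  choose u hu v hv huv using hatom
  have hne : ∀ i, u i ≠ v i := fun i h => by have := (huv i).1; rw [h] at this; omega
  -- the two-atom part `g` and the remainder `r` of each law
  set g : Fin N → ℤ → ℝ := fun i z => p * (if z = u i ∨ z = v i then (1 : ℝ) else 0) with hg
  set r : Fin N → ℤ → ℝ := fun i z => f i z - g i z with hr
  have hr0 : ∀ i z, 0 ≤ r i z := by
    intro i z
    simp only [hr, hg]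
    split_ifs with h
    · rcases h with rfl | rfl <;> linarith [(huv i).2.1, (huv i).2.2]
    · linarith [hf0 i z]
  have hrsum : ∀ i, ∑ z ∈ supp, r i z = 1 - 2 * p := by
    intro i
    have hfilt : supp.filter (fun z => z = u i ∨ z = v i) = {u i, v i} := by
      ext z
      simp only [mem_filter, mem_insert, mem_singleton]
      exact ⟨fun h => h.2, fun h => ⟨h.elim (fun h => h ▸ hu i) (fun h => h ▸ hv i), h⟩⟩
    simp only [hr, hg]
    rw [sum_sub_distrib, hf1 i, ← mul_sum, sum_boole, hfilt, card_pair (hne i)]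
    push_cast
    ring
  have hp2 : 2 * p ≤ 1 := by
    have := sum_nonneg (fun z (_ : z ∈ supp) => hr0 ⟨0, hN⟩ z)
    rw [hrsum] at this
    linarith
  set q : ℝ := 2 * p with hq
  -- the atoms as elements of the subtype `supp`, and the decomposition `f = g + r` there
  obtain ⟨u', hu'⟩ : ∃ u' : Fin N → supp, ∀ i, ((u' i : supp) : ℤ) = u i :=
    ⟨fun i => ⟨u i, hu i⟩, fun i => rfl⟩
  obtain ⟨v', hv'⟩ : ∃ v' : Fin N → supp, ∀ i, ((v' i : supp) : ℤ) = v i :=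
    ⟨fun i => ⟨v i, hv i⟩, fun i => rfl⟩
  have huv' : ∀ i, ((u' i : supp) : ℤ) + d ≤ ((v' i : supp) : ℤ) :=
    fun i => by rw [hu', hv']; exact (huv i).1
  have hfgr : ∀ (i : Fin N) (s : supp),
      f i s = p * (if s = u' i ∨ s = v' i then (1 : ℝ) else 0) + r i s := by
    intro i s
    have h1 : (s = u' i) ↔ ((s : ℤ) = u i) := by rw [Subtype.ext_iff, hu']
    have h2 : (s = v' i) ↔ ((s : ℤ) = v i) := by rw [Subtype.ext_iff, hv']
    simp only [h1, h2, hr, hg]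
    ring
  -- Steps 1–2: pass to `z : Fin N → supp`, expand the mixture (`prod_add`), exchange the sums,
  -- and bound each `T`-component by the conditioning step.
  have step12 : ∑ z ∈ (Fintype.piFinset fun _ : Fin N => supp) with
        (y ≤ ∑ i, z i ∧ ∑ i, z i < y + d), ∏ i, f i (z i)
      ≤ ∑ T ∈ (univ : Finset (Fin N)).powerset,
          p ^ #T * ((#T).choose (#T / 2) : ℝ) * (1 - q) ^ (N - #T) := by
    rw [sum_filter, sum_piFinset_eq_sum_pi]
    calc _ = ∑ z : Fin N → supp,
          (if y ≤ ∑ i, ((z i : supp) : ℤ) ∧ ∑ i, ((z i : supp) : ℤ) < y + d then (1 : ℝ) else 0) *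
            ∑ T ∈ (univ : Finset (Fin N)).powerset,
              (∏ i ∈ T, p * (if z i = u' i ∨ z i = v' i then (1 : ℝ) else 0)) *
                ∏ i ∈ univ \ T, r i (z i) :=
          Fintype.sum_congr _ _ (fun z => by
            rw [boole_mul, prod_congr rfl (fun i _ => hfgr i (z i)), prod_add])
      _ = ∑ T ∈ (univ : Finset (Fin N)).powerset, ∑ z : Fin N → supp,
          (if y ≤ ∑ i, ((z i : supp) : ℤ) ∧ ∑ i, ((z i : supp) : ℤ) < y + d then (1 : ℝ) else 0) *
            ((∏ i ∈ T, p * (if z i = u' i ∨ z i = v' i then (1 : ℝ) else 0)) *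
              ∏ i ∈ univ \ T, r i (z i)) := by
          simp_rw [mul_sum]
          exact sum_comm
      _ ≤ _ := sum_le_sum (fun T _ => ?_)
    have h2 : ∏ i ∈ univ \ T, ∑ s : supp, r i s = (1 - q) ^ (N - #T) := by
      rw [prod_congr rfl (fun i _ => by rw [sum_coe_sort supp (r i), hrsum i]), prod_const,
        card_univ_sdiff, Fintype.card_fin]
    exact (sum_window_prod_le N Subtype.val T u' v' d huv' p hp.le (fun i (s : supp) => r i s)
      (fun i s => hr0 i s) y).trans_eq (by rw [h2])
  -- Step 3: the middle binomial coefficient, linearised with `σ = √(N+1)`.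
  set σ : ℝ := Real.sqrt (N + 1) with hσ
  have hσpos : 0 < σ := Real.sqrt_pos.2 (by positivity)
  have hσ2 : σ ^ 2 = (N : ℝ) + 1 := Real.sq_sqrt (by positivity)
  have step3 : ∀ T : Finset (Fin N),
      p ^ #T * ((#T).choose (#T / 2) : ℝ) * (1 - q) ^ (N - #T)
        ≤ (1 / (2 * σ)) * (q ^ #T * (1 - q) ^ (N - #T))
          + (σ / 2) * (q ^ #T * (1 - q) ^ (N - #T) / (#T + 1)) := by
    intro T
    have h1 : 0 ≤ p ^ #T * (1 - q) ^ (N - #T) :=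
      mul_nonneg (pow_nonneg hp.le _) (pow_nonneg (by linarith) _)
    calc p ^ #T * ((#T).choose (#T / 2) : ℝ) * (1 - q) ^ (N - #T)
        = (p ^ #T * (1 - q) ^ (N - #T)) * ((#T).choose (#T / 2) : ℝ) := by ring
      _ ≤ (p ^ #T * (1 - q) ^ (N - #T)) * (2 ^ #T * (1 / (2 * σ) + σ / (2 * ((#T : ℝ) + 1)))) :=
          mul_le_mul_of_nonneg_left (middle_choose_le #T σ hσpos) h1
      _ = _ := by
          rw [hq, mul_pow]
          simp only [← div_div]
          ring
  -- Step 4: the two binomial averages, and assembly.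
  have hsumA : ∑ T ∈ (univ : Finset (Fin N)).powerset, q ^ #T * (1 - q) ^ (N - #T) = 1 := by
    have := Finset.sum_pow_mul_eq_add_pow q (1 - q) (univ : Finset (Fin N))
    rw [card_univ, Fintype.card_fin] at this
    rw [this, hq]
    simp
  have hsumB : ∑ T ∈ (univ : Finset (Fin N)).powerset,
      q ^ #T * (1 - q) ^ (N - #T) / (#T + 1) ≤ 1 / ((N + 1) * q) := by
    rw [le_div_iff₀ (by positivity)]
    calc _ = ((N : ℝ) + 1) * q * ∑ T ∈ (univ : Finset (Fin N)).powerset,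
          q ^ #T * (1 - q) ^ (N - #T) / (#T + 1) := by ring
      _ ≤ 1 := binomial_inv_succ_sum_le N q hp2
  calc _ ≤ _ := step12
    _ ≤ ∑ T ∈ (univ : Finset (Fin N)).powerset,
          ((1 / (2 * σ)) * (q ^ #T * (1 - q) ^ (N - #T))
            + (σ / 2) * (q ^ #T * (1 - q) ^ (N - #T) / (#T + 1))) :=
        sum_le_sum (fun T _ => step3 T)
    _ = (1 / (2 * σ)) * ∑ T ∈ (univ : Finset (Fin N)).powerset, q ^ #T * (1 - q) ^ (N - #T)
          + (σ / 2) * ∑ T ∈ (univ : Finset (Fin N)).powerset,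
              q ^ #T * (1 - q) ^ (N - #T) / (#T + 1) := by
        rw [sum_add_distrib, mul_sum, mul_sum]
    _ ≤ (1 / (2 * σ)) * 1 + (σ / 2) * (1 / ((N + 1) * q)) := by rw [hsumA]; gcongr
    _ = (1 / 2 + 1 / (4 * p)) / σ := by
        rw [hq, ← hσ2]
        field_simp
        ring
    _ ≤ (1 + 1 / (4 * p)) / σ := div_le_div_of_nonneg_right (by linarith) hσpos.le

end Summit.QuantumFields.QCD.Cruxes.WindowExtinction.WallConditionedCellSpread

end
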